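import Summits.ABC.IUTFork.Thm311RealInd1StripDepthEFixed
import Literature.IUT.LogVolume.UnitLogPrincipalRoots
import HarnessLib

/-!
# Radical uniformisers at TAME places of residue degree one: `π^e = m·p` with `‖π‖ = p^{−1/e}`, `0 < m < p`

PROOF-ONLY file (abc-iut cell, Cor. 3.12 sub-crew, seat abc-iut-c312-1 = holder of record of the typed [IUTchIII] Thm. 3.11, gen 19; row «R26 =
C:ROOM-SHARPNESS» item (θ3), C LEAD ruling C-R171 (a) ff.; file (κ1)).  Classical local algebra, UNCONDITIONAL; no definition, no `Prop` fact.  Kept on the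
Summits side only because it uses the residue-degree-one kit of p550084 (`Hull.exists_norm_sub_natCast_lt_one_of_residueDegree_eq_one`: `𝒪 = ℤ + 𝔪`).
* **`exists_norm_eq_and_pow_eq_natCast_mul`** — `p ∤ e`, `f = 1` ⟹ some `π` has `‖π‖ = p^{−1/e}` and `π^e = m·p`, `0 < m < p` (a uniformiser `ϖ`, the unit
  `u = ϖ^e/p ≡ m (mod 𝔪)`, `u/m` principal hence an `e`-th power by Newton — abc-iut-rp-d4 `PrincipalRoot.exists_pow_eq_of_isPrincipal`).  So a genuine
  completion at a tame place of residue degree one is the PURE RADICAL field `ℚ_p((m p)^{1/e})`, and its power basis `(π^j)_{j<e}` is available to the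
  radical monomial-box theorem `MonomialBox.box_of_mem_normalizedPacket_of_radical` (Literature `PacketMonomialBoxRadical`).
Nothing here is disputed mathematics; no side taken on [IUTchIII] Cor. 3.12; NO abc claim.
[cite: SerreLocalFields1979, Ch. I §6; Ch. IV §2] [cite: NeukirchANT1999, Ch. II (5.8)]
-/

set_option autoImplicit false

noncomputable section

open Metric Set
open scoped NormedField

namespace Summit.ABC.IUTFork.Thm311.Real.Radical

open Literature.IUT.LogVolume Literature.NumberTheory.GaloisRepresentations.Ultrametric

variable (p : ℕ) [Fact p.Prime]
variable (K : Type) [NontriviallyNormedField K] [NormedAlgebra ℚ_[p] K] [IsUltrametricDist K] [ProperSpace K]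

/-- **Radical uniformisers at a TAME place of residue degree one.**  If `p ∤ e` and `f = 1`, there is `π ∈ K` with `‖π‖ = p^{−1/e}` and
`π^e = m·p` for a rational integer `0 < m < p` (so `π^e ∈ ℚ_p`, `K = ℚ_p(π)` is pure radical): for a uniformiser `ϖ` the unit `u = ϖ^e/p` is `≡ m (mod 𝔪)`
(`𝒪 = ℤ + 𝔪` at residue degree one, p550084 kit) and `u/m` is a principal unit, an `e`-th power by Newton/Hensel (`PrincipalRoot.exists_pow_eq_of_isPrincipal`,
`p ∤ e`). [cite: SerreLocalFields1979, Ch. I §6; Ch. IV §2 Prop. 5] [cite: NeukirchANT1999, Ch. II (5.8)] -/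
theorem exists_norm_eq_and_pow_eq_natCast_mul (hpe : ¬ p ∣ absRamificationIdx p K) (hf : residueDegree p K = 1) :
    ∃ π : K, ‖π‖ = (p : ℝ) ^ (-(1 / (absRamificationIdx p K : ℝ))) ∧
      ∃ m : ℕ, 0 < m ∧ m < p ∧ π ^ absRamificationIdx p K = (m : K) * (p : K) := by
  have hP : p.Prime := Fact.out
  have hp0 : (0 : ℝ) < p := by exact_mod_cast hP.pos
  set e : ℕ := absRamificationIdx p K with he
  have he0 : 0 < e := absRamificationIdx_pos p K
  -- a uniformiser and the unit `u = ϖ^e / p`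
  set ϖ : Kˣ := unifChoice K with hϖdef
  have hϖ : IsUniformizer ϖ := isUniformizer_unifChoice K
  have hnϖ : ‖(ϖ : K)‖ = (p : ℝ) ^ (-(1 / (e : ℝ))) := norm_eq_rpow_of_isUniformizer p K hϖ
  have hnϖe : ‖(ϖ : K) ^ e‖ = (p : ℝ)⁻¹ := by rw [norm_pow]; exact norm_pow_absRamificationIdx p K hϖ
  have hpK : (p : K) ≠ 0 := by
    intro h; have := norm_prime p K; rw [h, norm_zero] at this; exact (inv_ne_zero hp0.ne') this.symm
  set u : K := (ϖ : K) ^ e / (p : K) with hu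
  have hnu : ‖u‖ = 1 := by rw [hu, norm_div, hnϖe, norm_prime p K, div_self (inv_ne_zero hp0.ne')]
  -- `u ≡ m (mod 𝔪)` with `0 ≤ m < p`; `m ≠ 0` since `u` is a unit
  obtain ⟨m, hmp, hum⟩ := Hull.exists_norm_sub_natCast_lt_one_of_residueDegree_eq_one p K hf u hnu.le
  have hm0 : 0 < m := by
    rcases Nat.eq_zero_or_pos m with h0 | h0
    · rw [h0, Nat.cast_zero, sub_zero, hnu] at hum; exact absurd hum (lt_irrefl _)
    · exact h0
  have hnm : ‖(m : K)‖ = 1 := by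
    have hnd : ¬ p ∣ m := fun hd => absurd (Nat.le_of_dvd hm0 hd) (by omega)
    rw [norm_natCast_eq_padicNorm p K]
    refine le_antisymm ?_ (not_lt.mp fun hlt => hnd ((Padic.norm_natCast_lt_one_iff).mp hlt))
    exact_mod_cast Padic.norm_int_le_one (p := p) (m : ℤ)
  have hmK : (m : K) ≠ 0 := by intro h; rw [h, norm_zero] at hnm; exact zero_ne_one hnm
  -- `u/m` is principal, hence an `e`-th power
  have hprin : IsPrincipal (u / (m : K)) := by
    change ‖1 - u / (m : K)‖ < 1
    rw [show (1 : K) - u / (m : K) = ((m : K) - u) / (m : K) by field_simp, norm_div, hnm, div_one, norm_sub_rev]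
    exact hum
  obtain ⟨w, -, hwe⟩ := PrincipalRoot.exists_pow_eq_of_isPrincipal p (k := e) hpe hprin
  have hw1 : ‖w‖ = 1 := norm_eq_one_of_isPrincipal_pow he0 (by rw [hwe]; exact hprin)
  have hw0 : w ≠ 0 := by intro h; rw [h, norm_zero] at hw1; exact zero_ne_one hw1
  refine ⟨(ϖ : K) / w, by rw [norm_div, hw1, div_one, hnϖ], m, hm0, hmp, ?_⟩
  rw [div_pow, hwe, hu]
  field_simp

end Summit.ABC.IUTFork.Thm311.Real.Radical
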